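import Literature.NumberTheory.EllipticCurves.IwasawaEisensteinTwistedRepDescentProofs
import Literature.NumberTheory.EllipticCurves.ZpExtensionScalarTwist
import Literature.NumberTheory.GaloisRepresentations.ContinuousCohomologyTransport
import HarnessLib

/-!
# Transport `Hⁿ(Γ_K, eisensteinTwist) ≃+ Hⁿ(Γ_K, TwistedBy χ M)`: D1's twisted Galois module versus the
# cocycle files' carrier

Topic `NumberTheory/EllipticCurves` (sequel to `ZpExtensionScalarTwist` (D1's `κ.eisensteinTwist ρ hm k : DiscreteGaloisModule K
(Twisted p m k M)`, whose cohomology `galoisCohomology _ 1` is the level-`k` term of Howard's `H¹(K, A_𝔮)` colimit `H1A`) and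
`IwasawaEisensteinTwistedRep` (the `DistribMulAction` carrier `TwistedBy χ M`, whose `discreteH1` is where the twisted-cocycle /
descent files live); cell `pub/bsd-print-x9`, blueprint HOME/p2/S1-DISCRETE-CONTROL §1 step F4a).  Definitions with bodies and
theorems; no named fact, no instance, no `sorry`.

Under the single hypothesis `hact : ∀ σ x, κ.eisensteinTwist ρ hm k σ x = ofTwisted⁻¹ (σ • ofTwisted x)` (the two actions agree —
discharged for `χ = eisensteinTwistChar κ hm k` and `ρ σ a = σ • a` by the dictionary `eisensteinTwist_apply_eq_twistedBy_smul`):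
* `eisensteinTwistToTwistedByHom` / `eisensteinTwistOfTwistedByHom`: the identity of the carrier as mutually inverse morphisms of
  topological `Γ_K`-representations `(κ.eisensteinTwist ρ hm k).toTopRep ⇄ discreteTopRep Γ_K (TwistedBy χ M)`;
* **`eisensteinTwistCohomologyEquiv n : galoisCohomology (κ.eisensteinTwist ρ hm k) n ≃+ continuousCohomology n (discreteTopRep Γ_K
  (TwistedBy χ M))`** (`continuousCohomologyAddEquivOfContinuousMulEquiv` along `Γ_K = Γ_K`), with its value on a 1-cocycle class
  (`eisensteinTwistCohomologyEquiv_oneCocycleClass`, `pullback_eisensteinTwistToTwistedByHom_apply`);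
* **`eisensteinTwistLevelReadout`**: the level-`k` discrete comparison map
  `H¹(K, eisensteinTwist) →+ H¹(K_∞, M)`, `c ↦ readout (res_{K_∞} c)` (transport, then `ResKernel.resSubgroup`, then the
  `tailReadout` push-forward of the descent file), and **`exists_eisensteinTwistLevelReadout_eq`**: every class of `H¹(K_∞, M)`
  killed by `ψ_m = (conj_γ − 1)^m + p` is in its image (from `TwistedBy.exists_readout_resSubgroup_eq`).

References: [Howard2004HeegnerKolyvagin] §2.2, Lemma 1.3.3 / proof of Thm. 2.2.10; [GreenbergLNM1716] §4 pp. 107, 124;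
[SerreGaloisCohomology1997] I §2.4.  BSD is not proved by any of this.
-/

noncomputable section

open Literature.NumberTheory.EllipticCurves Literature.NumberTheory.GaloisRepresentations Field
open CategoryTheory ContinuousCohomology IwasawaAlgebra IwasawaAlgebra.EisensteinCoeff IwasawaAlgebra.EisensteinCoeff.TwistedBy

universe u

namespace Literature.NumberTheory.EllipticCurves

namespace ZpExtension

variable {K : Type u} [Field K] {p : ℕ} [Fact p.Prime] (κ : ZpExtension K p) {m : ℕ} (hm : 1 ≤ m) (k : ℕ)
  {M : Type u} [AddCommGroup M] [DistribMulAction (absoluteGaloisGroup K) M] [TopologicalSpace M] [DiscreteTopology M]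
  (χ : absoluteGaloisGroup K →* EisensteinCoeff p m k) (ρ : DiscreteGaloisModule K M)
  (hact : ∀ (σ : absoluteGaloisGroup K) (x : Twisted p m k M),
    κ.eisensteinTwist ρ hm k σ x = (ofTwisted χ M).symm (σ • ofTwisted χ M x))

/-- **`eisensteinTwist ⟶ TwistedBy χ M`** (identity of the carrier `A_{m,k} ⊗ M`, as a morphism of topological
`Γ_K`-representations, `Γ_K` acting on the source through `(ContinuousMulEquiv.refl Γ_K)⁻¹ = id`); equivariant by `hact`.
[cite: Howard2004HeegnerKolyvagin, §2.2] [cite: SerreGaloisCohomology1997, I §2.4] -/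
def eisensteinTwistToTwistedByHom :
    TopRep.res (((ContinuousMulEquiv.refl (absoluteGaloisGroup K)).symm :
        absoluteGaloisGroup K →ₜ* absoluteGaloisGroup K) : absoluteGaloisGroup K →* absoluteGaloisGroup K)
        (κ.eisensteinTwist ρ hm k).toTopRep ⟶
      discreteTopRep (absoluteGaloisGroup K) (TwistedBy χ M) :=
  TopRep.ofHom
    { toFun := fun x => ofTwisted χ M x
      map_add' := fun x y => map_add _ x y
      map_smul' := fun n x => by
        rw [RingHom.id_apply]
        exact map_zsmul (ofTwisted χ M) n x
      cont := continuous_of_discreteTopology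
      isIntertwining' := fun σ ↦ by
        ext x
        change ofTwisted χ M (κ.eisensteinTwist ρ hm k σ x) = σ • ofTwisted χ M x
        rw [hact, AddEquiv.apply_symm_apply] }

/-- **`TwistedBy χ M ⟶ eisensteinTwist`** (identity of the carrier, the inverse morphism). [cite: Howard2004HeegnerKolyvagin, §2.2]
[cite: SerreGaloisCohomology1997, I §2.4] -/
def eisensteinTwistOfTwistedByHom :
    TopRep.res (((ContinuousMulEquiv.refl (absoluteGaloisGroup K)) :
        absoluteGaloisGroup K →ₜ* absoluteGaloisGroup K) : absoluteGaloisGroup K →* absoluteGaloisGroup K)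
        (discreteTopRep (absoluteGaloisGroup K) (TwistedBy χ M)) ⟶
      (κ.eisensteinTwist ρ hm k).toTopRep :=
  TopRep.ofHom
    { toFun := fun w => (ofTwisted χ M).symm w
      map_add' := fun x y => map_add _ x y
      map_smul' := fun n w => by
        rw [RingHom.id_apply]
        exact map_zsmul (ofTwisted χ M).symm n w
      cont := continuous_of_discreteTopology
      isIntertwining' := fun σ ↦ by
        ext w
        change (ofTwisted χ M).symm (σ • w) = κ.eisensteinTwist ρ hm k σ ((ofTwisted χ M).symm w)
        rw [hact, AddEquiv.apply_symm_apply] }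

/-- **`Hⁿ(K, eisensteinTwist) ≃+ Hⁿ(Γ_K, TwistedBy χ M)`**: D1's level-`k` cohomology of Howard's twisted module is the continuous
cohomology of the cocycle files' carrier (transport along the identity of `Γ_K` and of `A_{m,k} ⊗ M`).
[cite: Howard2004HeegnerKolyvagin, §2.2] [cite: SerreGaloisCohomology1997, I §2.4] -/
def eisensteinTwistCohomologyEquiv (n : ℕ) :
    galoisCohomology (κ.eisensteinTwist ρ hm k) n ≃+
      continuousCohomology n (discreteTopRep (absoluteGaloisGroup K) (TwistedBy χ M)) :=
  continuousCohomologyAddEquivOfContinuousMulEquiv (ContinuousMulEquiv.refl (absoluteGaloisGroup K))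
    (κ.eisensteinTwistToTwistedByHom hm k χ ρ hact) (κ.eisensteinTwistOfTwistedByHom hm k χ ρ hact)
    (fun _ => rfl) (fun _ => rfl) n

/-- The transport on a 1-cocycle class is the class of the pulled-back cocycle. [cite: SerreGaloisCohomology1997, I §2.4] -/
theorem eisensteinTwistCohomologyEquiv_oneCocycleClass (ξ : contOneCocycles (κ.eisensteinTwist ρ hm k).toTopRep) :
    κ.eisensteinTwistCohomologyEquiv hm k χ ρ hact 1 (oneCocycleClass _ ξ) =
      oneCocycleClass _ (contOneCocycles.pullback
        ((ContinuousMulEquiv.refl (absoluteGaloisGroup K)).symm : absoluteGaloisGroup K →ₜ* absoluteGaloisGroup K)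
        (κ.eisensteinTwistToTwistedByHom hm k χ ρ hact) ξ) :=
  map_oneCocycleClass _ _ _ ξ

/-- The pulled-back cocycle is `ξ` read in `TwistedBy χ M`: `σ ↦ ofTwisted (ξ σ)`. [cite: SerreGaloisCohomology1997, I §2.4] -/
theorem pullback_eisensteinTwistToTwistedByHom_apply (ξ : contOneCocycles (κ.eisensteinTwist ρ hm k).toTopRep)
    (σ : absoluteGaloisGroup K) :
    (contOneCocycles.pullback
        ((ContinuousMulEquiv.refl (absoluteGaloisGroup K)).symm : absoluteGaloisGroup K →ₜ* absoluteGaloisGroup K)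
        (κ.eisensteinTwistToTwistedByHom hm k χ ρ hact) ξ).1 σ = ofTwisted χ M (ξ.1 σ) := rfl

include hact in
/-- **A 1-cocycle of D1's `eisensteinTwist` is a twisted crossed homomorphism**: `ξ(στ) = ξ σ + χ σ • (1 ⊗ σ)(ξ τ)` — the shape `hf`
of the twisted-cocycle readout / injectivity files. [cite: Howard2004HeegnerKolyvagin, §2.2] [cite: GreenbergLNM1716, §4 p. 107] -/
theorem eisensteinTwist_contOneCocycles_apply_mul (ξ : contOneCocycles (κ.eisensteinTwist ρ hm k).toTopRep)
    (σ τ : absoluteGaloisGroup K) :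
    ξ.1 (σ * τ) = ξ.1 σ + χ σ • CoeffExtension.mapEnd
      ((DistribMulAction.toAddMonoidEnd (absoluteGaloisGroup K) M) σ) (ξ.1 τ) := by
  rw [ξ.2 σ τ]
  change ξ.1 σ + κ.eisensteinTwist ρ hm k σ (ξ.1 τ) = _
  rw [hact, ofTwisted_symm_smul, AddEquiv.symm_apply_apply]

variable (κ₀ : ZpExtension K p) (hM : ∀ a : M, p ^ k • a = 0) (hχker : ∀ σ ∈ κ₀.kerSubgroup, χ σ = 1)

/-- **The level-`k` discrete comparison map `H¹(K, M ⊗ A_{m,k}(χ)) →+ H¹(K_∞, M)`**, `c ↦ readout (res_{K_∞} c)`: transport to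
`TwistedBy χ M`, restrict to `Gal(K̄/K_∞) = ker κ₀`, push forward along the tail readout `A_{m,k} ⊗ M → M` (equivariant on `ker κ₀`
since `χ = 1` there).  For `M = E[p^k]`, `κ = κ₀⁻¹`: the level-`k` piece of Howard's `H¹(K, A_𝔮) → H¹(K_∞, E[p^∞])[𝔮]`.
[cite: Howard2004HeegnerKolyvagin, §2.2, proof of Thm. 2.2.10] [cite: GreenbergLNM1716, §4 p. 124] -/
def eisensteinTwistLevelReadout :
    galoisCohomology (κ.eisensteinTwist ρ hm k) 1 →+ subgroupH1 κ₀.kerSubgroup M :=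
  (resH1Hom (ContinuousMonoidHom.id κ₀.kerSubgroup)
      ((Twisted.tailReadout p hm k hM).comp (ofTwisted χ M).symm.toAddMonoidHom)
      (readout_id_smul κ₀ hm k hM hχker)).comp
    ((ResKernel.resSubgroup κ₀.kerSubgroup (TwistedBy χ M)).comp
      (κ.eisensteinTwistCohomologyEquiv hm k χ ρ hact 1).toAddMonoidHom)

/-- Unfolding `eisensteinTwistLevelReadout`. [cite: Howard2004HeegnerKolyvagin, §2.2] -/
theorem eisensteinTwistLevelReadout_apply (c : galoisCohomology (κ.eisensteinTwist ρ hm k) 1) :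
    κ.eisensteinTwistLevelReadout hm k χ ρ hact κ₀ hM hχker c =
      resH1Hom (ContinuousMonoidHom.id κ₀.kerSubgroup)
        ((Twisted.tailReadout p hm k hM).comp (ofTwisted χ M).symm.toAddMonoidHom)
        (readout_id_smul κ₀ hm k hM hχker)
        (ResKernel.resSubgroup κ₀.kerSubgroup (TwistedBy χ M) (κ.eisensteinTwistCohomologyEquiv hm k χ ρ hact 1 c)) := rfl

/-- **Surjectivity onto `H¹(K_∞, M)[ψ_m]`**: every class `s` of `H¹(K_∞, M)` with `((conj_γ − 1)^m + p) s = 0` is the readout of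
a class of `H¹(K, M ⊗ A_{m,k}(χ))`, for `γ` a topological generator of `κ₀`, `χ γ · (1+T) = 1`, `χ = 1` on an open subgroup and on
`ker κ₀`, `M` finite with open stabilisers and `M^{Gal(K̄/K_∞)} = 0` (descent file `TwistedBy.exists_readout_resSubgroup_eq`
transported to D1's module). Howard: «`H¹(K, A_𝔮) → H¹(K_∞, A)[𝔮]` is surjective up to the local terms».
[cite: Howard2004HeegnerKolyvagin, §2.2, proof of Thm. 2.2.10] [cite: GreenbergLNM1716, §4 pp. 107, 124] -/
theorem exists_eisensteinTwistLevelReadout_eq [NumberField K] [Finite M] {γ : absoluteGaloisGroup K}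
    (hγ : κ₀.IsTopGenerator γ) (hχγ : χ γ * EisensteinCoeff.onePlusT p m k = 1)
    (U : Subgroup (absoluteGaloisGroup K)) (hU : IsOpen (U : Set (absoluteGaloisGroup K))) (hχU : ∀ σ ∈ U, χ σ = 1)
    (hstab : ∀ a : M, IsOpen ((MulAction.stabilizer (absoluteGaloisGroup K) a : Subgroup _) : Set (absoluteGaloisGroup K)))
    (hfix : ∀ a : M, (∀ σ ∈ κ₀.kerSubgroup, σ • a = a) → a = 0)
    (θ : AddMonoid.End (subgroupH1 κ₀.kerSubgroup M)) (hθ : ∀ c, θ c = conjH1 κ₀.kerSubgroup M γ c)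
    (s : subgroupH1 κ₀.kerSubgroup M) (hs : ((θ - 1) ^ m + (p : AddMonoid.End (subgroupH1 κ₀.kerSubgroup M))) s = 0) :
    ∃ c : galoisCohomology (κ.eisensteinTwist ρ hm k) 1, κ.eisensteinTwistLevelReadout hm k χ ρ hact κ₀ hM hχker c = s := by
  obtain ⟨Y, hY⟩ := exists_readout_resSubgroup_eq κ₀ hm k hM hχker hγ hχγ U hU hχU hstab hfix θ hθ s hs
  refine ⟨(κ.eisensteinTwistCohomologyEquiv hm k χ ρ hact 1).symm Y, ?_⟩
  rw [eisensteinTwistLevelReadout_apply, AddEquiv.apply_symm_apply, hY]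

end ZpExtension

end Literature.NumberTheory.EllipticCurves
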